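import Summits.QuantumFields.YangMills.Theorems.ParabolicTrajectoryContinuumLimitOnTrajectoryJCGDefs

/-!
# Route `ParabolicTrajectory`, crux `ContinuumLimitOnTrajectory` (stmt-QuantumFields-10522): proved glue of line `jacobian-collapse-gronwall`

Companion PROOF file of the vocabulary `…JCGDefs` (lead seat `prover-line-stmt-QuantumFields-10522-c1-0`): the planner's Cauchy
bookkeeping across scales is PROVED (`cauchyBookkeeping_holds : CauchyBookkeeping`, registered statement C of the skeleton
`Cruxes/ContinuumLimitOnTrajectory/Lines/jacobian_collapse_gronwall.lean`, verbatim from the planner's skeleton — the card's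
cheapest Lean falsifier (d) passes), together with the elementary glue the composition `stubsImplyCrux` consumes (`exists_isProfile`,
`IsProfile.halve`, `log_decade`) and the sorry-free check that the ultralocal witness of
`Negative.continuumLimitOnTrajectory_false_without_AF` never enters the scaling region (`timeSmeared_zero_coupling`).
Pure real analysis / bookkeeping over Mathlib plus the tree's landed Negative lemmas; no lattice estimate is claimed.
-/

set_option autoImplicit false

open scoped SchwartzMap
open MeasureTheory Filter Topology
open Literature.MathematicalPhysics.QuantumFieldTheory Literature.MathematicalPhysics.QuantumLattice
open Summit.QuantumFields.YangMills.Theses.ParabolicTrajectory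

noncomputable section

namespace Summit.QuantumFields.YangMills.Cruxes.ContinuumLimitOnTrajectory.JacobianCollapseGronwall

/-! ### The Cauchy bookkeeping is PROVED (the card's cheapest Lean falsifier (d): if it needed more than the
hypotheses listed, the architecture would be wrong — it does not) -/

/-- **`CauchyBookkeeping` holds** (sorry-free): enlarge both volumes to `max(L_k, L_{k'})`, ascend the lower
state through the decades (defect `≤` tail of `Σ η`, brancher kept in its collar), compare at equal level and
volume (`Lip · |ΔN|`), undo the volume enlargement by finite-size insensitivity. -/
theorem cauchyBookkeeping_holds : CauchyBookkeeping := by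
  intro ι i₀ X N B θ₁ θ₂ ρ₁ ρ₂ lM η Lip vol n₀ hlM hvol hη0 hηs hLip0 hT hL nk Lk βk Θ Rinf δ
    hnk hvolk hBk hNΘ hΘ hR hδ hcollar hfsN hfsX i
  -- tails of the defect series
  have hTsum : ∀ i n, Summable fun l => η i (l + n) := fun i n => (summable_nat_add_iff n).2 (hηs i)
  have hT0 : ∀ i, Tendsto (fun n => ∑' l, η i (l + n)) atTop (𝓝 0) := fun i => tendsto_sum_nat_add (η i)
  have hpartial : ∀ i n j, ∑ l ∈ Finset.range j, η i (n + l) ≤ ∑' l, η i (l + n) := by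
    intro i n j
    have h := (hTsum i n).sum_le_tsum (Finset.range j) (fun l _ => hη0 i _)
    simpa [add_comm] using h
  -- the collar
  have hρ₁ : ρ₁ < Rinf - 4 * δ := (hcollar ⟨le_rfl, by linarith⟩).1
  have hρ₂ : Rinf + 4 * δ < ρ₂ := (hcollar ⟨by linarith, le_rfl⟩).2
  -- ASCENT through `j` decades at fixed volume
  have ascent : ∀ (L n : ℕ), n₀ ≤ n → (∑' l, η i₀ (l + n)) * lM ≤ δ → ∀ β₀ : ℝ,
      β₀ ∈ levelWindow X N i₀ B θ₁ θ₂ ρ₁ ρ₂ n L →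
      X i₀ n L β₀ ∈ Set.Icc (Rinf - 2 * δ) (Rinf + 2 * δ) →
      ∀ j : ℕ, vol (n + j) ≤ L →
        ∃ βj : ℝ, β₀ ≤ βj ∧ N (n + j) L βj = N n L β₀ ∧
          |X i (n + j) L βj - X i n L β₀| ≤ (∑ l ∈ Finset.range j, η i (n + l)) * lM ∧
          |X i₀ (n + j) L βj - X i₀ n L β₀| ≤ (∑ l ∈ Finset.range j, η i₀ (n + l)) * lM := by
    intro L n hn htail β₀ hβ₀ hR₀ j
    induction j with
    | zero => intro; exact ⟨β₀, le_rfl, by simp, by simp, by simp⟩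
    | succ j ih =>
      intro hvj
      have hvj' : vol (n + j) ≤ L := (hvol (by omega)).trans hvj
      obtain ⟨βj, hle, hNj, hXj, hRj⟩ := ih hvj'
      have hsum : (∑ l ∈ Finset.range j, η i₀ (n + l)) * lM + η i₀ (n + j) * lM ≤ δ := by
        have h1 := hpartial i₀ n (j + 1)
        rw [Finset.sum_range_succ] at h1
        have h2 := mul_le_mul_of_nonneg_right h1 hlM
        rw [add_mul] at h2
        exact h2.trans htail
      have hηn : 0 ≤ η i₀ (n + j) * lM := mul_nonneg (hη0 _ _) hlM
      have hsn : 0 ≤ (∑ l ∈ Finset.range j, η i₀ (n + l)) * lM :=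
        mul_nonneg (Finset.sum_nonneg fun l _ => hη0 _ _) hlM
      have hRj' := abs_le.1 hRj
      have hmem : βj ∈ levelWindow X N i₀ B θ₁ θ₂ ρ₁ ρ₂ (n + j) L := by
        refine ⟨hβ₀.1.trans hle, ?_, ?_⟩
        · rw [hNj]; exact hβ₀.2.1
        · constructor <;> linarith [hR₀.1, hR₀.2, hRj'.1, hRj'.2]
      have hpre : X i₀ (n + j) L βj ∈
          Set.Ioo (ρ₁ + η i₀ (n + j) * lM) (ρ₂ - η i₀ (n + j) * lM) := by
        constructor <;> linarith [hR₀.1, hR₀.2, hRj'.1, hRj'.2]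
      obtain ⟨β', hle', hN', hX'⟩ := hT (n + j) L (by omega) hvj' βj hmem hpre
      have hnj : n + (j + 1) = n + j + 1 := by ring
      refine ⟨β', hle.trans hle', ?_, ?_, ?_⟩
      · rw [hnj, hN', hNj]
      · rw [Finset.sum_range_succ, add_mul, hnj]
        calc |X i (n + j + 1) L β' - X i n L β₀|
            ≤ |X i (n + j + 1) L β' - X i (n + j) L βj| + |X i (n + j) L βj - X i n L β₀| :=
              abs_sub_le _ _ _
          _ ≤ η i (n + j) * lM + (∑ l ∈ Finset.range j, η i (n + l)) * lM := add_le_add (hX' i) hXj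
          _ = _ := by ring
      · rw [Finset.sum_range_succ, add_mul, hnj]
        calc |X i₀ (n + j + 1) L β' - X i₀ n L β₀|
            ≤ |X i₀ (n + j + 1) L β' - X i₀ (n + j) L βj| + |X i₀ (n + j) L βj - X i₀ n L β₀| :=
              abs_sub_le _ _ _
          _ ≤ η i₀ (n + j) * lM + (∑ l ∈ Finset.range j, η i₀ (n + l)) * lM := add_le_add (hX' i₀) hRj
          _ = _ := by ring
  -- the Cauchy estimate
  rw [Metric.cauchySeq_iff]
  intro ε₀ hε₀
  set ε : ℝ := ε₀ / 5 with hεdef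
  have hε : 0 < ε := by positivity
  obtain ⟨hΘ1, hΘ2⟩ := hΘ
  have hLi : 0 ≤ Lip i := hLip0 i
  set τ : ℝ := min (min (Θ - θ₁) (θ₂ - Θ) / 3) (ε / (4 * (Lip i + 1))) with hτdef
  have hτ : 0 < τ := by
    rw [hτdef]
    refine lt_min ?_ (by positivity)
    have : 0 < min (Θ - θ₁) (θ₂ - Θ) := lt_min (by linarith) (by linarith)
    linarith
  have hτθ₁ : 3 * τ ≤ Θ - θ₁ := by
    have h1 : τ ≤ min (Θ - θ₁) (θ₂ - Θ) / 3 := min_le_left _ _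
    have h2 := min_le_left (Θ - θ₁) (θ₂ - Θ)
    linarith
  have hτθ₂ : 3 * τ ≤ θ₂ - Θ := by
    have h1 : τ ≤ min (Θ - θ₁) (θ₂ - Θ) / 3 := min_le_left _ _
    have h2 := min_le_right (Θ - θ₁) (θ₂ - Θ)
    linarith
  have hτε : 4 * (Lip i + 1) * τ ≤ ε := by
    have h1 : τ ≤ ε / (4 * (Lip i + 1)) := min_le_right _ _
    rw [le_div_iff₀ (by positivity)] at h1
    linarith
  -- tails are eventually small
  have htail₀ : ∀ᶠ n in atTop, (∑' l, η i₀ (l + n)) * lM < δ := by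
    have h := (hT0 i₀).mul_const lM
    rw [zero_mul] at h
    exact h.eventually_lt_const hδ
  have htail : ∀ᶠ n in atTop, (∑' l, η i (l + n)) * lM < ε := by
    have h := (hT0 i).mul_const lM
    rw [zero_mul] at h
    exact h.eventually_lt_const hε
  obtain ⟨n₁, hn₁⟩ := eventually_atTop.1 ((eventually_ge_atTop n₀).and (htail₀.and htail))
  -- everything eventually in `k`
  have hk4 : ∀ᶠ k in atTop, |N (nk k) (Lk k) (βk k) - Θ| < τ := by
    have h := Metric.tendsto_nhds.1 hNΘ τ hτ
    filter_upwards [h] with k hk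
    rwa [Real.dist_eq] at hk
  have hk6 : ∀ᶠ k in atTop, |X i₀ (nk k) (Lk k) (βk k) - Rinf| < δ := by
    have h := Metric.tendsto_nhds.1 hR δ hδ
    filter_upwards [h] with k hk
    rwa [Real.dist_eq] at hk
  obtain ⟨K, hK⟩ := eventually_atTop.1 ((hnk.eventually_ge_atTop n₁).and (hvolk.and (hBk.and
    (hk4.and ((hfsN τ hτ).and (hk6.and ((hfsX i₀ δ hδ).and (hfsX i ε hε))))))))
  -- the estimate for ordered levels
  have key : ∀ k k', K ≤ k → K ≤ k' → nk k ≤ nk k' →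
      |X i (nk k) (Lk k) (βk k) - X i (nk k') (Lk k') (βk k')| ≤ 4 * ε := by
    intro k k' hk hk' hle
    obtain ⟨h1, h2, h3, h4, h5, h6, h7, h8⟩ := hK k hk
    obtain ⟨h1', h2', h3', h4', h5', h6', h7', h8'⟩ := hK k' hk'
    obtain ⟨hn₀k, htδ, htε⟩ := hn₁ (nk k) h1
    obtain ⟨hn₀k', -, -⟩ := hn₁ (nk k') h1'
    set S : ℕ := max (Lk k) (Lk k') with hS
    have hSk : Lk k ≤ S := le_max_left _ _
    have hSk' : Lk k' ≤ S := le_max_right _ _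
    have fN := abs_le.1 (h5 S hSk)
    have fN' := abs_le.1 (h5' S hSk')
    have fR := abs_le.1 (h7 S hSk)
    have fX := abs_le.1 (h8 S hSk)
    have fX' := abs_le.1 (h8' S hSk')
    have dN := abs_lt.1 h4
    have dN' := abs_lt.1 h4'
    have dR := abs_lt.1 h6
    -- window membership of the volume-enlarged sequence states
    have memk : βk k ∈ levelWindow X N i₀ B θ₁ θ₂ ρ₁ ρ₂ (nk k) S := by
      refine ⟨h3, ⟨?_, ?_⟩, ⟨?_, ?_⟩⟩ <;>
        linarith [fN.1, fN.2, dN.1, dN.2, fR.1, fR.2, dR.1, dR.2]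
    have hR0 : X i₀ (nk k) S (βk k) ∈ Set.Icc (Rinf - 2 * δ) (Rinf + 2 * δ) := by
      constructor <;> linarith [fR.1, fR.2, dR.1, dR.2]
    have fR' := abs_le.1 (h7' S hSk')
    have dR'' := abs_lt.1 h6'
    have memk' : βk k' ∈ levelWindow X N i₀ B θ₁ θ₂ ρ₁ ρ₂ (nk k') S := by
      refine ⟨h3', ⟨?_, ?_⟩, ⟨?_, ?_⟩⟩ <;>
        linarith [fN'.1, fN'.2, dN'.1, dN'.2, fR'.1, fR'.2, dR''.1, dR''.2]
    -- ascend from level `nk k` to level `nk k'` at volume `S`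
    have hvS : vol (nk k + (nk k' - nk k)) ≤ S := by
      rw [Nat.add_sub_cancel' hle]; exact h2'.trans hSk'
    obtain ⟨βs, hles, hNs, hXs, hRs⟩ := ascent S (nk k) hn₀k htδ.le (βk k) memk hR0 (nk k' - nk k) hvS
    rw [Nat.add_sub_cancel' hle] at hNs hXs hRs
    have hXs' : |X i (nk k') S βs - X i (nk k) S (βk k)| ≤ ε :=
      hXs.trans ((mul_le_mul_of_nonneg_right (hpartial i _ _) hlM).trans htε.le)
    have hRs' : |X i₀ (nk k') S βs - X i₀ (nk k) S (βk k)| ≤ δ :=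
      hRs.trans ((mul_le_mul_of_nonneg_right (hpartial i₀ _ _) hlM).trans htδ.le)
    have hRs'' := abs_le.1 hRs'
    have mems : βs ∈ levelWindow X N i₀ B θ₁ θ₂ ρ₁ ρ₂ (nk k') S := by
      refine ⟨h3.trans hles, ?_, ⟨?_, ?_⟩⟩
      · rw [hNs]; exact memk.2.1
      · linarith [hR0.1, hRs''.1]
      · linarith [hR0.2, hRs''.2]
    -- same level, same volume
    have hsame := hL (nk k') S hn₀k' (h2'.trans hSk') βs mems (βk k') memk' i
    have hNdiff : |N (nk k') S βs - N (nk k') S (βk k')| ≤ 4 * τ := by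
      rw [hNs, abs_le]
      constructor <;> linarith [fN.1, fN.2, dN.1, dN.2, fN'.1, fN'.2, dN'.1, dN'.2]
    have hsame' : |X i (nk k') S βs - X i (nk k') S (βk k')| ≤ ε := by
      refine hsame.trans ?_
      calc Lip i * |N (nk k') S βs - N (nk k') S (βk k')| ≤ Lip i * (4 * τ) :=
            mul_le_mul_of_nonneg_left hNdiff hLi
        _ ≤ ε := by nlinarith [hτε, hτ.le, hLi]
    -- assemble
    have hXs'' := abs_le.1 hXs'
    have hsame'' := abs_le.1 hsame'
    rw [abs_le]
    constructor <;> linarith [fX.1, fX.2, fX'.1, fX'.2, hXs''.1, hXs''.2, hsame''.1, hsame''.2]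
  refine ⟨K, fun m hm m' hm' => ?_⟩
  rw [Real.dist_eq]
  have h4ε : 4 * ε < ε₀ := by rw [hεdef]; linarith
  rcases le_total (nk m) (nk m') with h | h
  · exact (key m m' hm hm' h).trans_lt h4ε
  · rw [abs_sub_comm]; exact (key m' m hm' hm h).trans_lt h4ε


/-- A time profile exists (a smooth bump around `u = 3/2` of radii `1/8 < 1/4`). -/
theorem exists_isProfile : ∃ φ : ℝ → ℝ, IsProfile φ := by
  let b : ContDiffBump (3 / 2 : ℝ) := ⟨1 / 8, 1 / 4, by norm_num, by norm_num⟩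
  refine ⟨b, ⟨b.contDiff, fun u => b.nonneg, ⟨5 / 4, 7 / 4, by norm_num, by norm_num, ?_⟩, ⟨3 / 2, ?_⟩⟩⟩
  · intro u hu
    rw [b.support_eq] at hu
    have hu' : dist u (3 / 2) < 1 / 4 := hu
    rw [Real.dist_eq, abs_lt] at hu'
    constructor <;> linarith [hu'.1, hu'.2]
  · have h1 : (b : ℝ → ℝ) (3 / 2) = 1 :=
      b.one_of_mem_closedBall (Metric.mem_closedBall_self b.rIn_pos.le)
    rw [h1]; norm_num

/-- The halved profile `u ↦ φ(u/2)` (support in `(2, ∞)`) is again a profile. -/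
theorem IsProfile.halve {φ : ℝ → ℝ} (h : IsProfile φ) : IsProfile fun u => φ (u / 2) where
  smooth := h.smooth.comp (contDiff_id.div_const 2)
  nonneg := fun u => h.nonneg _
  supported := by
    obtain ⟨a, b, ha, hab, hs⟩ := h.supported
    refine ⟨2 * a, 2 * b, by linarith, by linarith, fun u hu => ?_⟩
    have hu' : u / 2 ∈ Function.support φ := hu
    have h2 := hs hu'
    constructor <;> linarith [h2.1, h2.2]
  nontrivial := by
    obtain ⟨u, hu⟩ := h.nontrivial
    refine ⟨2 * u, ?_⟩
    have : (2 * u) / 2 = u := by ring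
    simpa [this] using hu

/-- `log (Mⁿ⁺¹ / Mⁿ) = log M`. -/
theorem log_decade {M : ℕ} (hM : 2 ≤ M) (n : ℕ) :
    Real.log ((M : ℝ) ^ (n + 1) / (M : ℝ) ^ n) = Real.log M := by
  have hM0 : (M : ℝ) ≠ 0 := by exact_mod_cast (by omega : M ≠ 0)
  congr 1
  rw [pow_succ, mul_comm, mul_div_assoc, div_self (pow_ne_zero _ hM0), mul_one]



/-! ## Checks against the landed Negative lemmas (sorry-free)

The load-bearing pair of `Negative.continuumLimitOnTrajectory_false_without_AF` is honoured: the ultralocal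
scheme `β ≡ 0` (the witness of that theorem) never ENTERS the scaling region — its tuning observable is
identically `0` from the second step on, so `Θ > 0` of stub D fails for it, exactly as it must. -/

section Checks

variable {G : Type} [Group G] [TopologicalSpace G] [IsTopologicalGroup G] [CompactSpace G]
  [MeasurableSpace G] [BorelSpace G]

/-- At `β = 0` the time-smeared tuning observable VANISHES for every profile (no window state at zero
coupling): each summand has `φ(s/D) = 0` for `s = 0` (profiles live beyond `u = 1`, `D > 0`) and
`⟨P ; τ_s P⟩_{0} = 0` for `0 < s ≤ L < 2L+1` (`Negative.latticeConnectedCorr_actionDensity_zero`). -/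
theorem timeSmeared_zero_coupling (r : LatticeRep G) {φ : ℝ → ℝ} (hφ : IsProfile φ) {L : ℕ} (hL : 1 ≤ L)
    (D : ℝ) : timeSmeared r φ L D 0 = 0 := by
  haveI : SecondCountableTopology G :=
    (r.continuous.isClosedEmbedding r.injective).isEmbedding.secondCountableTopology
  unfold timeSmeared
  refine Finset.sum_eq_zero fun s hs => ?_
  rcases Nat.eq_zero_or_pos s with rfl | hs0
  · obtain ⟨a, b, ha, -, hsupp⟩ := hφ.supported
    have h0 : φ 0 = 0 := by
      by_contra h
      have := (hsupp (Function.mem_support.2 h)).1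
      linarith
    simp [h0]
  · have hsL : s < 2 * L + 1 := by
      have := Finset.mem_range.1 hs
      omega
    have hcorr : G2 r 0 L s = 0 := by
      unfold G2
      rw [Summit.QuantumFields.YangMills.Theorems.ContinuumLimitOnTrajectory.Negative.curvature_F]
      exact Summit.QuantumFields.YangMills.Theorems.ContinuumLimitOnTrajectory.Negative.latticeConnectedCorr_actionDensity_zero
        r.ρ (2 * L + 1)
        (Summit.QuantumFields.YangMills.Theorems.ContinuumLimitOnTrajectory.Negative.one_ne_zero_zmod (by omega))
        r.continuous
        (Summit.QuantumFields.YangMills.Theorems.ContinuumLimitOnTrajectory.Negative.natCast_zmod_ne_zero hs0 hsL)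
    simp [hcorr]

open Summit.QuantumFields.YangMills.Theorems.ContinuumLimitOnTrajectory.Negative (ultralocalScheme) in
/-- Along the ultralocal scheme `β ≡ 0` (THE witness of `Negative.continuumLimitOnTrajectory_false_without_AF`)
the time-smeared tuning observable is identically `0`, so conclusion (d1) of stub D (`Θ > 0`) fails for it — the
witness never enters the scaling region, as it must not. -/
theorem not_tendsto_timeSmeared_ultralocal (r : LatticeRep G) {M : ℕ} (hM : 2 ≤ M) {φ : ℝ → ℝ} (hφ : IsProfile φ)
    (n : ℕ → ℕ) {Θ : ℝ}
    (hΘ : 0 < Θ) :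
    ¬ Tendsto (fun k => timeSmeared r φ ((ultralocalScheme (YMSpecies G) hM).L k) ((M : ℝ) ^ n k)
        ((ultralocalScheme (YMSpecies G) hM).β k)) atTop (𝓝 Θ) := by
  intro h
  have hMpos : 0 < M := by omega
  have h0 : (fun k => timeSmeared r φ ((ultralocalScheme (YMSpecies G) hM).L k) ((M : ℝ) ^ n k)
      ((ultralocalScheme (YMSpecies G) hM).β k)) = fun _ => 0 := by
    funext k
    have hL : 1 ≤ (ultralocalScheme (YMSpecies G) hM).L k :=
      Nat.succ_le_of_lt (Nat.mul_pos (Nat.pow_pos hMpos) (Nat.succ_pos k))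
    exact timeSmeared_zero_coupling r hφ hL _
  rw [h0] at h
  have := tendsto_nhds_unique h tendsto_const_nhds
  linarith

end Checks

end Summit.QuantumFields.YangMills.Cruxes.ContinuumLimitOnTrajectory.JacobianCollapseGronwall

end
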